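import Literature.MathematicalPhysics.QuantumFieldTheory.Balaban1983to89.Node00.OpsYSectEElimSmall
import Literature.MathematicalPhysics.QuantumFieldTheory.Balaban1983to89.T4AxialGaugeSmallField
import Literature.MathematicalPhysics.QuantumFieldTheory.Balaban1983to89.NodeOTorusBlocks

/-!
# NODE 00 — Sect. E of [B9]: the pivot coefficients `K_c(V)`, `K_c(V)*` are LOCAL, and are units for fields of SMALL CURVATURE on `B(c₋) ∪ B(c₊)`

[cite: Balaban1985BackgroundPropagators, (3.157) p.428, (3.35) p.397, (3.32) p.396; Balaban1985Averaging, Prop. 1 p.26, (55)–(58) p.27, (109) p.34, (124)–(126) p.36;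
Balaban1985RegularSpaces, Lemma 1 p.79, (1.25)]

`Node00/OpsYSectEElim.lean` (FILE 13 of the def-Y lineage) builds the bond elimination `C(V) = elimCY` of (3.157) through the pivot coefficients
`K_c(V) = KY x 𝔳 U c : a ↦ (Q(V)(δ_{b₀(c)} ⊗ a))(c)` and their transposes `K_c(V)* = KTY`; `Node00/OpsYSectEElimSmall.lean` (FILE 14) proves them units
for SMALL FIELDS (`isUnit_KY_of_small`: `‖V(b) − 1‖ ≤ δ` on EVERY unit bond, `L^{d+1}·2δ·(L + (d+1)ℓ) < 1`) and shows that invertibility is a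
GAUGE-ORBIT property (`isUnit_KY_ugauge_iff`, `isUnit_KTY_ugauge_iff` under `V ↦ V^γ`, `V^γ(b) = γ(b₋)V(b)γ(b₊)⁻¹ = ugaugeY`), leaving as its declared
margin (i) the EXISTENCE of a gauge in which a field of small curvature is small near `c`.

THIS FILE closes that margin, in print's regime (3.35) ∕ [5] (109) `|V(∂p) − 1| ≤ α₀ on B(c₋) ∪ B(c₊)`:

§1 LOCALITY ([5] p.34: «the definition of `(V₁)_c, c ⊂ Ω₁^{(k)}`, involves only the gauge fields at bonds `b ⊂ B_k(c₋) ∪ B_k(c₊)`»): `K_c(V)` and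
`K_c(V)*` read `V` only on the unit bonds of the straight segments `[z, z + L·e_μ]`, `z ∈ B(c₋)`, and of the block combs `Γ_{c₋,z}` (`ReadsY`;
`KY_congr`, `KTY_congr` — two fields agreeing there have the same pivot coefficients; from the chain congruences `hol_congr_on`, `trSum_congr_on`,
`trSumT_congr_on`).
§2 LOCAL SMALLNESS suffices (`isUnit_KY_KTY_of_small_on`: FILE 14's `isUnit_KY_of_small` applied to the field truncated to `1` off the read bonds).
§3 THE AXIAL GAUGE OF THE DOUBLE BLOCK: in the relative label chart at the corner `c₋ = y` (`relY`, `ofZ_labK_add_relY`, `relY_shift`) the field pulls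
back to the tree's `ℤ^{d+1}` carrier (`VzY`), the tree's axial gauge function `B7Prop1Explicit.axialFn` (= `V(Γ_{y,x})`, [5] (52)–(53)) defines a site
function `axialY` on the unit torus, and on every bond whose relative label does not wrap `V^{axialY}(b)` IS the tree's `gaugeAct (axialFn V y) V`
(`ugaugeY_axialY`); the read bonds of `K_c` sit in the box `[y, y + pairTop L μ]` = `B(c₋) ∪ B(c₊)` in labels (`relY_add_unitVec_le_pairTop_of_readsY`,
the double block never wraps since the member's period holds `M_h·P′ ≥ 40` blocks: `two_mul_le_sitesPerDir_k`), where the tree's sharp non-abelian Stokes bound `B8Lemma1NonAbelian.axial_bond_bound_sharp`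
([B8] Lemma 1 p.79 ∕ [5] Prop. 1 p.26: `|V^u(b) − 1| ≤ l1(lowPart(x − y))·a ≤ d(2L−1)·a` for plaquettes `a`-small in the box) applies
(`norm_ugaugeY_axialY_sub_one_le`).
§4 ★ `isUnit_KY_KTY_of_plaqSmall`: for `V = 𝔳 U` valued in the contraction group `U1` (`‖g‖ ≤ 1 ∧ ‖g⁻¹‖ ≤ 1`, e.g. `U(N)`), plaquettes `a`-small on
the double block of `c` (`PlaqSmall (VzY V) (labK c₋) (labK c₋ + pairTop L μ) a`) and `L^{d+1}·2·(d(2ℓ+1)a)·(L + (d+1)ℓ) < 1`, BOTH `K_c(V)` and `K_c(V)*`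
are units — the hypothesis of FILE 13's three faces (`Q1Y_elimCY`, `elimCY_eq_self_of_constraints`, `sum_tr_elimCY_mul`) in print's own currency.
§5 At the record (`𝔸 = M_N(ℂ)` with the C⋆-norm, `G ≤ U(N)`, `V = avYOfRecord x U`): `isUnit_KY_KTY_avYOfRecord_of_plaqSmall`.

## Honest margins
(i) CONSTANTS: `d(2ℓ+1)·a` per bond and the counting constant of FILE 14 are cruder than print's `O(L²α₀)`; they depend on `d, L` only, as print's do.
(ii) The reading `IsCoarseY` of `Λ′` (corner + both end blocks good) and the whole-torus carrier are those of FILE 13; the no-wrap fact `2L ≤ sitesPerDir_k` is DERIVED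
from the member's `8 ≤ M_h`, `5 ≤ P′_μ` (`two_mul_le_sitesPerDir_k`), not assumed.
(iii) `U1`-valued fields only (the tree's [B8] Lemma 1 setting); nothing here touches `D2J`, `Gt2`, (3.158)–(3.185), or any continuum statement.
-/

noncomputable section

namespace Literature.MathematicalPhysics.QuantumFieldTheory.Balaban1983to89.Node00

open B9Eq3169Mu
open B9Eq39Adjoint (R R_one)
open B9PinMembersKLevelV1 (MemberY)
open B6Elimination (corner mem_block mem_block_corner_iff corner_corner)
open B6GlobalChartV1 (PV domT)
open B6BondElimination (unitVec unitVec_apply)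
open B9Eq3169Comb (comb corner_of_mem_comb)
open B7Prop1Explicit (U1 mem_U1 axialFn gaugeAct axialFn_mem)
open B8Lemma1NonAbelian (lowPart pairTop axial_bond_bound_sharp)

variable {d ℓ : ℕ} {hd : 1 ≤ d + 1} {hL : Odd (ℓ + 1) ∧ 1 < ℓ + 1} {b₀ b₁ : ℝ} {Mstar : ℕ}

/-! ## §1 Locality of the pivot coefficients -/

section ChainCongr

variable {Bond 𝔤 : Type} [AddCommGroup 𝔤] [Module ℝ 𝔤]

/-- transports agreeing on the bonds of a chain have the same composite transport along it. [cite: Balaban1985BackgroundPropagators, p.390 («R(U(Γ))»), bookkeeping] -/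
theorem hol_congr_on (T T' : Bond → 𝔤 ≃ₗ[ℝ] 𝔤) : ∀ (Γ : List Bond), (∀ b ∈ Γ, T' b = T b) → hol T' Γ = hol T Γ
  | [], _ => rfl
  | b :: Γ, h => by
    refine LinearEquiv.ext fun v => ?_
    rw [hol_cons_apply, hol_cons_apply, h b (by simp), hol_congr_on T T' Γ fun b' hb' => h b' (List.mem_cons_of_mem b hb')]

/-- transported sums along a chain depend only on the transports on the chain. [cite: Balaban1985BackgroundPropagators, (3.169) p.430, bookkeeping] -/
theorem trSum_congr_on (T T' : Bond → 𝔤 ≃ₗ[ℝ] 𝔤) (B : Bond → 𝔤) : ∀ (Γ : List Bond), (∀ b ∈ Γ, T' b = T b) → trSum T' B Γ = trSum T B Γ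
  | [], _ => rfl
  | b :: Γ, h => by
    rw [trSum_cons, trSum_cons, h b (by simp), trSum_congr_on T T' B Γ fun b' hb' => h b' (List.mem_cons_of_mem b hb')]

end ChainCongr

section ChainCongrT

variable {Bond 𝔤 : Type} [NormedAddCommGroup 𝔤] [NormedSpace ℝ 𝔤] [DecidableEq Bond]

/-- the transposed transported sums along a chain depend only on the transports on the chain. [cite: Balaban1985BackgroundPropagators, (3.9) p.391, bookkeeping] -/
theorem trSumT_congr_on (S S' : Bond → 𝔤 ≃ₗ[ℝ] 𝔤) : ∀ (Γ : List Bond), (∀ b ∈ Γ, S' b = S b) → ∀ v, trSumT S' Γ v = trSumT S Γ v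
  | [], _, v => by rw [trSumT_nil, trSumT_nil]
  | b :: Γ, h, v => by
    rw [trSumT_cons, trSumT_cons, h b (by simp), trSumT_congr_on S S' Γ (fun b' hb' => h b' (List.mem_cons_of_mem b hb')) (S b v)]

end ChainCongrT

section Locality

variable {𝔸 : Type} [NormedRing 𝔸] [NormedAlgebra ℂ 𝔸] [CompleteSpace 𝔸]
variable (x : MemberY d ℓ hd hL b₀ b₁ Mstar)

/-- **THE UNIT BONDS READ BY `K_c(V)` AND `K_c(V)*`** at `c = (y, μ)`: the bonds of the straight segments `[z, z + L·e_μ]`, `z ∈ B(y)`, and the unit bonds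
under the index bonds of the block combs `Γ_{y,z}` — all inside `B(c₋) ∪ B(c₊)`. [cite: Balaban1985Averaging, p.34 («involves only the gauge fields at bonds
b ⊂ B_k(c₋) ∪ B_k(c₊)»), (125) p.36, dictionary] -/
def ReadsY (c : USiteY x × Fin (d + 1)) (b : UBondY x) : Prop :=
  ∃ z ∈ ublockY x c.1, b ∈ usegY x z c.2 ∨ ∃ q ∈ uΓ x z, b = ubondOfIdx x q

variable (𝔳 𝔳' : AvY 𝔸 x)

/-- ★ **LOCALITY OF `K_c(V)`**: two averaged fields agreeing on the read bonds of `c` have the same pivot coefficient at `c`. [cite: Balaban1985Averaging, p.34, (125) p.36;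
Balaban1985BackgroundPropagators, p.428] -/
theorem KY_congr {U U' : CfgY 𝔸 x.toKIdx} (c : CBondY x) (h : ∀ b, ReadsY x c.1 b → 𝔳' U' b = 𝔳 U b) : KY x 𝔳' U' c = KY x 𝔳 U c := by
  apply LinearMap.ext
  intro a
  rw [KY_apply, KY_apply, Q1Y_apply, Q1Y_apply]
  refine congrArg _ (Finset.sum_congr rfl fun z hz => ?_)
  have hΓ : ∀ q ∈ uΓ x z, RVY x 𝔳' U' q = RVY x 𝔳 U q := fun q hq => by
    have e := h _ ⟨z, hz, Or.inr ⟨q, hq, rfl⟩⟩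
    unfold RVY
    rw [e]
  have hS : ∀ b ∈ usegY x z c.1.2, RUY x 𝔳' U' b = RUY x 𝔳 U b := fun b hb => by
    have e := h _ ⟨z, hz, Or.inl hb⟩
    unfold RUY
    rw [e]
  rw [hol_congr_on _ _ (uΓ x z) hΓ, trSum_congr_on _ _ _ (usegY x z c.1.2) hS]

/-- ★ **LOCALITY OF `K_c(V)*`**. [cite: Balaban1985Averaging, p.34, (125) p.36; Balaban1985BackgroundPropagators, p.428, (3.9) p.391] -/
theorem KTY_congr {U U' : CfgY 𝔸 x.toKIdx} (c : CBondY x) (h : ∀ b, ReadsY x c.1 b → 𝔳' U' b = 𝔳 U b) : KTY x 𝔳' U' c = KTY x 𝔳 U c := by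
  classical
  apply LinearMap.ext
  intro v
  rw [KTY_apply, KTY_apply, Q1TY_apply, Q1TY_apply]
  unfold q1TFunY
  refine congrArg (fun F : IBondY x.toKIdx → 𝔸 => (qNormY d ℓ • F) (pivIY x c)) (Finset.sum_congr rfl fun z hz => ?_)
  have hΓ : ∀ q ∈ uΓ x z, RVY x 𝔳' U' q = RVY x 𝔳 U q := fun q hq => by
    have e := h _ ⟨z, hz, Or.inr ⟨q, hq, rfl⟩⟩
    unfold RVY
    rw [e]
  have hS : ∀ b ∈ usegY x z c.1.2, RUTY x 𝔳' U' b = RUTY x 𝔳 U b := fun b hb => by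
    have e := h _ ⟨z, hz, Or.inl hb⟩
    unfold RUTY RUY
    rw [e]
  rw [hol_congr_on _ _ (uΓ x z) hΓ, trSumT_congr_on _ _ (usegY x z c.1.2) hS]

/-! ## §2 Local smallness suffices -/

/-- ★ **LOCAL SMALL FIELD ⇒ `K_c(V)`, `K_c(V)*` UNITS**: FILE 14's `isUnit_KY_of_small` ∕ `isUnit_KTY_of_small` with membership and smallness asked only on
the read bonds of `c` (the field truncated to `1` elsewhere has the same pivot coefficients, §1). [cite: Balaban1985Averaging, (109) p.34, (124)–(126) p.36;
Balaban1985BackgroundPropagators, p.428] -/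
theorem isUnit_KY_KTY_of_small_on {G : Subgroup 𝔸ˣ} (hG1 : ∀ g ∈ G, ‖((g : 𝔸ˣ) : 𝔸)‖ ≤ 1) {U : CfgY 𝔸 x.toKIdx} (c : CBondY x)
    (h𝔳 : ∀ b, ReadsY x c.1 b → 𝔳 U b ∈ G) {δ : ℝ} (hδ0 : 0 ≤ δ) (hδ : ∀ b, ReadsY x c.1 b → ‖((𝔳 U b : 𝔸ˣ) : 𝔸) - 1‖ ≤ δ)
    (hsmall : (((ℓ + 1 : ℕ) : ℝ)) ^ (d + 1) * (2 * δ * (((ℓ + 1 : ℕ) + (d + 1) * ℓ : ℕ) : ℝ)) < 1) :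
    IsUnit (KY x 𝔳 U c) ∧ IsUnit (KTY x 𝔳 U c) := by
  classical
  let 𝔳'' : AvY 𝔸 x := fun U' b => if ReadsY x c.1 b then 𝔳 U' b else 1
  have hag : ∀ b, ReadsY x c.1 b → 𝔳'' U b = 𝔳 U b := fun b hb => if_pos hb
  have hoff : ∀ b, ¬ ReadsY x c.1 b → 𝔳'' U b = 1 := fun b hb => if_neg hb
  have h1 : ∀ b, 𝔳'' U b ∈ G := fun b => by
    by_cases hb : ReadsY x c.1 b
    · rw [hag b hb]; exact h𝔳 b hb
    · rw [hoff b hb]; exact G.one_mem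
  have h2 : ∀ b, ‖((𝔳'' U b : 𝔸ˣ) : 𝔸) - 1‖ ≤ δ := fun b => by
    by_cases hb : ReadsY x c.1 b
    · rw [hag b hb]; exact hδ b hb
    · rw [hoff b hb, Units.val_one, sub_self, norm_zero]; exact hδ0
  rw [← KY_congr x 𝔳 𝔳'' c hag, ← KTY_congr x 𝔳 𝔳'' c hag]
  exact ⟨isUnit_KY_of_small x 𝔳'' hG1 h1 hδ0 h2 hsmall c, isUnit_KTY_of_small x 𝔳'' hG1 h1 hδ0 h2 hsmall c⟩

end Locality

/-! ## §3 The axial gauge of the double block, transported from the tree's `ℤ^{d+1}` carrier -/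

section AxialChart

variable {𝔸 : Type} [NormedRing 𝔸]
variable (x : MemberY d ℓ hd hL b₀ b₁ Mstar)

/-- **PULLBACK of a unit-torus bond field to the tree's `ℤ^{d+1}` carrier** (periodic): `V♯(w, ν) = V(⟨w mod period, ν⟩)`. [cite: Balaban1985Averaging, (52)–(53) p.26,
dictionary] -/
def VzY (V : UBondY x → 𝔸ˣ) : B7Prop1Explicit.Site (d + 1) → Fin (d + 1) → 𝔸ˣ := fun w ν => V ⟨ofZ x w, ν⟩

/-- **RELATIVE LABEL** of `z` seen from `y`: the representative in `[0, period)` of `z − y`, coordinatewise. [cite: Balaban1984PropagatorsII, (2.1) p.224, dictionary] -/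
def relY (y z : USiteY x) : Fin (d + 1) → ℤ := labK x (fun i => z i - y i)

/-- relative labels are nonnegative. [cite: Balaban1984PropagatorsII, (2.1) p.224, bookkeeping] -/
theorem relY_nonneg (y z : USiteY x) : 0 ≤ relY x y z := fun i => labK_nonneg x _ i

/-- relative labels are below the period. [cite: Balaban1984PropagatorsII, (2.1) p.224, bookkeeping] -/
theorem relY_lt (y z : USiteY x) (i : Fin (d + 1)) : relY x y z i < (PV d ℓ x.m x.K hd hL).sitesPerDir x.k := labK_lt x _ i

/-- **TWO BLOCKS PER PERIOD**: `2L ≤ L·M_h·P′_μ = sitesPerDir_k` (from the member's `8 ≤ M_h`, `5 ≤ P′_μ`), so the double block `B(c₋) ∪ B(c₊)` never wraps.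
[cite: Balaban1985BackgroundPropagators, p.399 (`M`, the k-th lattice); Balaban1984PropagatorsII, (2.1) p.224, bookkeeping] -/
theorem two_mul_le_sitesPerDir_k : 2 * (ℓ + 1) ≤ (PV d ℓ x.m x.K hd hL).sitesPerDir x.k := by
  rw [sitesPerDir_k x 0, Nat.mul_comm 2]
  exact Nat.mul_le_mul_left _ (le_trans (by norm_num) (Nat.mul_le_mul x.hM8 (x.hP5 0)))

/-- `y + rel_y(z) = z` in the chart. [cite: Balaban1984PropagatorsII, (2.1) p.224, bookkeeping] -/
theorem ofZ_labK_add_relY (y z : USiteY x) : ofZ x (labK x y + relY x y z) = z := by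
  funext i
  simp only [ofZ, labK, relY, Pi.add_apply, Int.cast_add, Int.cast_natCast, ZMod.natCast_zmod_val]
  abel

/-- the relative label of `y + r` is `r` for `r` in the fundamental box. [cite: Balaban1984PropagatorsII, (2.1) p.224, bookkeeping] -/
theorem relY_ofZ_add (y : USiteY x) {r : Fin (d + 1) → ℤ} (hr : ∀ i, 0 ≤ r i ∧ r i < (PV d ℓ x.m x.K hd hL).sitesPerDir x.k) :
    relY x y (ofZ x (labK x y + r)) = r := by
  have e : (fun i => ofZ x (labK x y + r) i - y i) = ofZ x r := by
    funext i
    simp only [ofZ, labK, Pi.add_apply, Int.cast_add, Int.cast_natCast, ZMod.natCast_zmod_val]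
    abel
  unfold relY
  rw [e, labK_ofZ x hr]

/-- the relative label of a block point seen from the block's corner is `labK z − labK y ∈ [0, ℓ]^{d+1}`. [cite: Balaban1984PropagatorsI, (1.6) p.18, bookkeeping] -/
theorem relY_of_mem_ublockY {y z : USiteY x} (hy : IsCornerY x y) (hz : z ∈ ublockY x y) :
    relY x y z = labK x z - labK x y ∧ ∀ i, 0 ≤ (labK x z - labK x y) i ∧ (labK x z - labK x y) i ≤ ℓ := by
  have hb := labK_mem_block_of_mem_ublockY x hz
  rw [(isCornerY_iff x y).1 hy, mem_block] at hb
  have hr : ∀ i, 0 ≤ (labK x z - labK x y) i ∧ (labK x z - labK x y) i ≤ ℓ := fun i => by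
    obtain ⟨h1, h2⟩ := hb i
    rw [Pi.sub_apply]
    constructor <;> push_cast at h2 <;> omega
  refine ⟨?_, hr⟩
  have h := relY_ofZ_add x y (r := labK x z - labK x y) fun i => ⟨(hr i).1, by
    have := labK_lt x z i; have := labK_nonneg x y i; rw [Pi.sub_apply]; omega⟩
  have e2 : labK x y + (labK x z - labK x y) = labK x z := by abel
  rwa [e2, ofZ_labK] at h

/-- one lattice step in the relative chart (no wrap): `rel_y(z + e_ν) = rel_y(z) + e_ν`. [cite: Balaban1985BackgroundPropagators, (3.168) p.430, bookkeeping] -/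
theorem relY_shift (y z : USiteY x) (ν : Fin (d + 1)) (h : relY x y z ν + 1 < (PV d ℓ x.m x.K hd hL).sitesPerDir x.k) :
    relY x y (z.shift ν) = relY x y z + unitVec ν := by
  have hz : z.shift ν = ofZ x (labK x y + (relY x y z + unitVec ν)) := by
    rw [← add_assoc, ofZ_add_unitVec, ofZ_labK_add_relY]
  rw [hz, relY_ofZ_add x y]
  intro i
  refine ⟨add_nonneg (relY_nonneg x y z i) (by rw [unitVec_apply]; split_ifs <;> norm_num), ?_⟩
  rw [Pi.add_apply, unitVec_apply]
  split_ifs with hi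
  · subst hi; exact h
  · rw [add_zero]; exact relY_lt x y z i

/-- **THE AXIAL GAUGE FUNCTION OF THE DOUBLE BLOCK AT `y`** on the unit torus: `z ↦ V(Γ_{y, y + rel_y(z)})`, the tree's `axialFn` (= [5] (52)–(53)'s contour
variable along the `d`-first taxi tree from the corner) read through the relative chart. [cite: Balaban1985Averaging, (52)–(58) pp.26–27; Balaban1985RegularSpaces, Lemma 1 p.79] -/
def axialY (V : UBondY x → 𝔸ˣ) (y : USiteY x) : USiteY x → 𝔸ˣ := fun z => axialFn (VzY x V) (labK x y) (labK x y + relY x y z)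

/-- ★ **THE GAUGE-TRANSFORMED FIELD IS THE TREE'S**: on a bond whose relative label does not wrap, `V^{axialY}(b) = (axialFn V♯ y)·V♯·(axialFn V♯ y)⁻¹` at the
label of `b`. [cite: Balaban1985Averaging, (55) p.27; Balaban1985RegularSpaces, Lemma 1 p.79] -/
theorem ugaugeY_axialY (V : UBondY x → 𝔸ˣ) (y : USiteY x) (b : UBondY x) (h : relY x y b.src b.dir + 1 < (PV d ℓ x.m x.K hd hL).sitesPerDir x.k) :
    ugaugeY x (axialY x V y) V b = gaugeAct (axialFn (VzY x V) (labK x y)) (VzY x V) (labK x y + relY x y b.src) b.dir := by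
  have e1 : VzY x V (labK x y + relY x y b.src) b.dir = V b := by
    show V ⟨ofZ x (labK x y + relY x y b.src), b.dir⟩ = V b
    rw [ofZ_labK_add_relY]
  have e2 : labK x y + relY x y b.tgt = labK x y + relY x y b.src + B7Prop1Explicit.e b.dir := by
    rw [show b.tgt = b.src.shift b.dir from rfl, relY_shift x y b.src b.dir h, NodeOTorusBlocks.unitVec_eq_e, add_assoc]
  rw [ugaugeY_apply]
  unfold gaugeAct
  rw [e1]
  show axialFn (VzY x V) (labK x y) (labK x y + relY x y b.src) * V b * (axialFn (VzY x V) (labK x y) (labK x y + relY x y b.tgt))⁻¹ = _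
  rw [e2]

end AxialChart

section AxialBound

variable {𝔸 : Type} [NormedRing 𝔸] [NormOneClass 𝔸]
variable (x : MemberY d ℓ hd hL b₀ b₁ Mstar)

/-- the axial gauge function is `U1`-valued on `U1`-valued fields. [cite: Balaban1985RegularSpaces, Lemma 1 p.79, bookkeeping] -/
theorem axialY_mem {V : UBondY x → 𝔸ˣ} (hV : ∀ b, V b ∈ U1 𝔸) (y z : USiteY x) : axialY x V y z ∈ U1 𝔸 :=
  axialFn_mem (fun _ _ => hV _) _ _

/-- the gauge-transformed field is `U1`-valued. [cite: Balaban1985Averaging, (55) p.27, bookkeeping] -/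
theorem ugaugeY_axialY_mem {V : UBondY x → 𝔸ˣ} (hV : ∀ b, V b ∈ U1 𝔸) (y : USiteY x) (b : UBondY x) : ugaugeY x (axialY x V y) V b ∈ U1 𝔸 := by
  rw [ugaugeY_apply]
  exact (U1 𝔸).mul_mem ((U1 𝔸).mul_mem (axialY_mem x hV y _) (hV b)) ((U1 𝔸).inv_mem (axialY_mem x hV y _))

/-- the slot coordinate of the double-block top: `2L − 1 = 2ℓ + 1`. [cite: Balaban1985RegularSpaces, Lemma 1 p.79 («B(c₋) ∪ B(c₊)»), bookkeeping] -/
theorem pairTop_apply_self (μ : Fin (d + 1)) : pairTop (ℓ + 1) μ μ = 2 * (ℓ : ℤ) + 1 := by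
  simp only [pairTop]; push_cast; ring

/-- the other coordinates of the double-block top: `L − 1 = ℓ`. [cite: Balaban1985RegularSpaces, Lemma 1 p.79, bookkeeping] -/
theorem pairTop_apply_ne {μ i : Fin (d + 1)} (h : i ≠ μ) : pairTop (ℓ + 1) μ i = (ℓ : ℤ) := by
  simp only [pairTop, if_neg h]; push_cast; ring

/-- every coordinate of the double-block top is at most `2ℓ + 1`. [cite: Balaban1985RegularSpaces, Lemma 1 p.79, bookkeeping] -/
theorem pairTop_apply_le (μ i : Fin (d + 1)) : pairTop (ℓ + 1) μ i ≤ 2 * (ℓ : ℤ) + 1 := by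
  by_cases h : i = μ
  · rw [h, pairTop_apply_self]
  · rw [pairTop_apply_ne h]; omega

/-- ★ **[B8] LEMMA 1 ∕ [5] PROP. 1 ON THE UNIT TORUS**: if the plaquettes of a `U1`-valued field are `a`-small on the double block `[y, y + pairTop L μ]` (labels) and the
period holds two blocks (`two_mul_le_sitesPerDir_k`), then on every bond `b` with `rel_y(b₋) + e_{ν(b)} ≤ pairTop L μ` the axially gauged field is within `d(2ℓ+1)·a` of `1`.
[cite: Balaban1985RegularSpaces, Lemma 1 p.79, (1.25); Balaban1985Averaging, Prop. 1 p.26, (57)–(58) p.27] -/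
theorem norm_ugaugeY_axialY_sub_one_le {V : UBondY x → 𝔸ˣ} (hV : ∀ b, V b ∈ U1 𝔸)
    (y : USiteY x) (μ : Fin (d + 1)) {a : ℝ} (ha : 0 ≤ a) (hP : B8Lemma1NonAbelian.PlaqSmall (VzY x V) (labK x y) (labK x y + pairTop (ℓ + 1) μ) a) {b : UBondY x}
    (htop : relY x y b.src + unitVec b.dir ≤ pairTop (ℓ + 1) μ) :
    ‖((ugaugeY x (axialY x V y) V b : 𝔸ˣ) : 𝔸) - 1‖ ≤ ((d * (2 * ℓ + 1) : ℕ) : ℝ) * a := by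
  have hVz : ∀ w κ, VzY x V w κ ∈ U1 𝔸 := fun _ _ => hV _
  have hr0 : 0 ≤ relY x y b.src := relY_nonneg x y b.src
  have hN' : (2 * (ℓ + 1) : ℤ) ≤ ((PV d ℓ x.m x.K hd hL).sitesPerDir x.k : ℤ) := by exact_mod_cast two_mul_le_sitesPerDir_k x
  have hle : ∀ κ, relY x y b.src κ ≤ ((2 * ℓ + 1 : ℕ) : ℤ) := fun κ => by
    have h1 : relY x y b.src κ + unitVec b.dir κ ≤ pairTop (ℓ + 1) μ κ := htop κ
    have u0 : 0 ≤ unitVec b.dir κ := by rw [unitVec_apply]; split_ifs <;> norm_num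
    have p1 := pairTop_apply_le (ℓ := ℓ) μ κ
    push_cast
    linarith
  have hνN : relY x y b.src b.dir + 1 < ((PV d ℓ x.m x.K hd hL).sitesPerDir x.k : ℤ) := by
    have h1 : relY x y b.src b.dir + unitVec b.dir b.dir ≤ pairTop (ℓ + 1) μ b.dir := htop b.dir
    rw [unitVec_apply, if_pos rfl] at h1
    have p1 := pairTop_apply_le (ℓ := ℓ) μ b.dir
    linarith
  rw [ugaugeY_axialY x V y b hνN]
  have key := axial_bond_bound_sharp (VzY x V) hVz hP (labK x y) (labK x y + relY x y b.src) b.dir le_rfl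
    (le_add_of_nonneg_right hr0) (by rw [add_assoc, ← NodeOTorusBlocks.unitVec_eq_e]; exact (add_le_add_iff_left (labK x y)).2 htop)
  rw [add_sub_cancel_left] at key
  refine key.trans (mul_le_mul_of_nonneg_right ?_ ha)
  have h2 := T4AxialGaugeSmallField.l1_lowPart_le b.dir hr0 hle
  have h3 : (b.dir : ℕ) ≤ d := Nat.lt_succ_iff.1 b.dir.is_lt
  calc (B7Prop1Explicit.l1 (lowPart b.dir (relY x y b.src)) : ℝ) ≤ (((b.dir : ℕ) * (2 * ℓ + 1) : ℕ) : ℝ) := by exact_mod_cast h2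
    _ ≤ ((d * (2 * ℓ + 1) : ℕ) : ℝ) := by exact_mod_cast Nat.mul_le_mul_right _ h3

end AxialBound

section ReadBonds

variable {𝔸 : Type} [NormedRing 𝔸] [NormedAlgebra ℂ 𝔸] [CompleteSpace 𝔸]
variable (x : MemberY d ℓ hd hL b₀ b₁ Mstar)

/-- the unit bond under an index bond of a block comb is a comb bond in labels. [cite: Balaban1985Averaging, p.24; Balaban1985BackgroundPropagators, (3.168) p.430, bookkeeping] -/
theorem exists_comb_of_mem_uΓ {z : USiteY x} {q : IBondY x.toKIdx} (hq : q ∈ uΓ x z) :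
    ∃ b' ∈ comb (ℓ + 1) (labK x z), ubondOfIdx x q = ⟨ofZ x b'.1, b'.2⟩ := by
  unfold uΓ at hq
  split_ifs at hq with h
  · rw [List.mem_pmap] at hq
    obtain ⟨b', hb', e⟩ := hq
    exact ⟨b', hb', by rw [← e, ubondOfIdx_idxOfU]⟩
  · simp at hq

/-- ★ **THE READ BONDS OF `K_c` LIE IN THE DOUBLE BLOCK `B(c₋) ∪ B(c₊)`**: in the relative chart at `c₋`, `rel(b₋) + e_{ν(b)} ≤ pairTop L μ` for every bond read by
`K_c`, `c = (y, μ) ∈ Λ′` (two blocks per period). [cite: Balaban1985Averaging, p.34 («bonds b ⊂ B_k(c₋) ∪ B_k(c₊)»), (14) p.19, p.24; Balaban1985RegularSpaces, Lemma 1 p.79] -/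
theorem relY_add_unitVec_le_pairTop_of_readsY (c : CBondY x) {b : UBondY x}
    (hb : ReadsY x c.1 b) : relY x c.1.1 b.src + unitVec b.dir ≤ pairTop (ℓ + 1) c.1.2 := by
  have hy : IsCornerY x c.1.1 := (isCoarseY_of x c).1
  have hN' : (2 * (ℓ + 1) : ℤ) ≤ ((PV d ℓ x.m x.K hd hL).sitesPerDir x.k : ℤ) := by exact_mod_cast two_mul_le_sitesPerDir_k x
  obtain ⟨z, hz, hb | ⟨q, hq, rfl⟩⟩ := hb
  · -- a segment bond `⟨z + s·e_μ, μ⟩`, `s ≤ ℓ`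
    obtain ⟨s, hs, rfl⟩ := (mem_usegY x).1 hb
    obtain ⟨hρ, hr⟩ := relY_of_mem_ublockY x hy hz
    have e : labK x z + ((s : ℕ) : ℤ) • unitVec c.1.2 = labK x c.1.1 + ((labK x z - labK x c.1.1) + ((s : ℕ) : ℤ) • unitVec c.1.2) := by abel
    have hrel : relY x c.1.1 (ofZ x (labK x z + ((s : ℕ) : ℤ) • unitVec c.1.2)) = (labK x z - labK x c.1.1) + ((s : ℕ) : ℤ) • unitVec c.1.2 := by
      rw [e, relY_ofZ_add x c.1.1]
      intro i
      have h1 := hr i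
      simp only [Pi.add_apply, Pi.smul_apply, smul_eq_mul]
      by_cases hi : i = c.1.2
      · subst hi
        rw [unitVec_apply, if_pos rfl, mul_one]
        constructor <;> omega
      · rw [unitVec_apply, if_neg hi, mul_zero, add_zero]
        constructor <;> omega
    intro i
    show relY x c.1.1 (ofZ x (labK x z + ((s : ℕ) : ℤ) • unitVec c.1.2)) i + unitVec c.1.2 i ≤ pairTop (ℓ + 1) c.1.2 i
    rw [hrel]
    have h1 := hr i
    simp only [Pi.add_apply, Pi.smul_apply, smul_eq_mul]
    by_cases hi : i = c.1.2
    · subst hi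
      rw [unitVec_apply, if_pos rfl, mul_one, pairTop_apply_self]
      omega
    · rw [unitVec_apply, if_neg hi, mul_zero, add_zero, add_zero, pairTop_apply_ne hi]
      omega
  · -- a comb bond `⟨w, ν⟩` of `Γ_{y,z}`: both ends in `B(y)`
    obtain ⟨b', hb', e⟩ := exists_comb_of_mem_uΓ x hq
    rw [e]
    have hc1 : corner (ℓ + 1) (labK x z) = labK x c.1.1 := by rw [(mem_ublockY x).1 hz, (isCornerY_iff x _).1 hy]
    have hsrc := mem_block_of_mem_comb x z hb'
    have htgt : b'.1 + unitVec b'.2 ∈ B6Elimination.block (ℓ + 1) (corner (ℓ + 1) (labK x z)) :=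
      (mem_block_corner_iff ell_succ_pos).2 (corner_of_mem_comb ell_succ_pos _ b' hb').2
    have hbox := inBox_of_mem_block x hsrc
    rw [hc1, mem_block] at hsrc htgt
    have ew : b'.1 = labK x c.1.1 + (b'.1 - labK x c.1.1) := by abel
    have hrel : relY x c.1.1 (ofZ x b'.1) = b'.1 - labK x c.1.1 := by
      rw [ew, relY_ofZ_add x c.1.1, ← ew]
      intro i
      have h1 := hsrc i; have h2 := hbox i; have h3 := labK_nonneg x c.1.1 i
      rw [Pi.sub_apply]
      constructor <;> omega
    intro i
    show relY x c.1.1 (ofZ x b'.1) i + unitVec b'.2 i ≤ pairTop (ℓ + 1) c.1.2 i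
    rw [hrel, Pi.sub_apply]
    have h1 := htgt i
    rw [Pi.add_apply] at h1
    have p0 : (ℓ : ℤ) ≤ pairTop (ℓ + 1) c.1.2 i := by
      by_cases hi : i = c.1.2
      · rw [hi, pairTop_apply_self]; omega
      · rw [pairTop_apply_ne hi]
    push_cast at h1
    omega

end ReadBonds

/-! ## §4 Small curvature on the double block ⇒ `K_c(V)`, `K_c(V)*` units -/

section AxialUnit

variable {𝔸 : Type} [NormedRing 𝔸] [NormedAlgebra ℂ 𝔸] [CompleteSpace 𝔸] [NormOneClass 𝔸]
variable (x : MemberY d ℓ hd hL b₀ b₁ Mstar) (𝔳 : AvY 𝔸 x)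

/-- ★★ **SMALL CURVATURE ON `B(c₋) ∪ B(c₊)` ⇒ THE PIVOT COEFFICIENTS `K_c(V)`, `K_c(V)*` ARE UNITS** (print: (3.157) solved for `B(b₀(c))` under (3.35)): for a
`U1`-valued averaged field `V = 𝔳 U` whose plaquettes are `a`-small on the double block of `c` (labels `[c₋, c₋ + pairTop L μ]`; it never wraps, `two_mul_le_sitesPerDir_k`) and
`L^{d+1}·2(d(2ℓ+1)a)·(L + (d+1)ℓ) < 1`, both `K_c(V)` and `K_c(V)*` are units — via the axial gauge of the double block (§3: `V^{axialY}` is `d(2ℓ+1)a`-small on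
the read bonds), the gauge-orbit invariance of invertibility (`isUnit_KY_ugauge_iff`, `isUnit_KTY_ugauge_iff`) and local smallness (§2).
[cite: Balaban1985BackgroundPropagators, (3.157) p.428, (3.35) p.397, (3.32) p.396; Balaban1985Averaging, (55)–(58) p.27, (109) p.34, (124)–(126) p.36;
Balaban1985RegularSpaces, Lemma 1 p.79] -/
theorem isUnit_KY_KTY_of_plaqSmall {U : CfgY 𝔸 x.toKIdx} (hV : ∀ b, 𝔳 U b ∈ U1 𝔸)
    (c : CBondY x) {a : ℝ} (ha : 0 ≤ a) (hP : B8Lemma1NonAbelian.PlaqSmall (VzY x (𝔳 U)) (labK x c.1.1) (labK x c.1.1 + pairTop (ℓ + 1) c.1.2) a)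
    (hsmall : (((ℓ + 1 : ℕ) : ℝ)) ^ (d + 1) * (2 * ((((d * (2 * ℓ + 1) : ℕ) : ℝ)) * a) * (((ℓ + 1 : ℕ) + (d + 1) * ℓ : ℕ) : ℝ)) < 1) :
    IsUnit (KY x 𝔳 U c) ∧ IsUnit (KTY x 𝔳 U c) := by
  let 𝔳' : AvY 𝔸 x := fun U' => ugaugeY x (axialY x (𝔳 U) c.1.1) (𝔳 U')
  have hV' : ∀ b, 𝔳' U b = ugaugeY x (axialY x (𝔳 U) c.1.1) (𝔳 U) b := fun b => rfl
  rw [← isUnit_KY_ugauge_iff x 𝔳 𝔳' hV' c, ← isUnit_KTY_ugauge_iff x 𝔳 𝔳' hV' c]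
  refine isUnit_KY_KTY_of_small_on x 𝔳' (G := U1 𝔸) (fun g hg => (mem_U1.1 hg).1) c (fun b _ => ugaugeY_axialY_mem x hV c.1.1 b)
    (δ := (((d * (2 * ℓ + 1) : ℕ) : ℝ)) * a) (by positivity) (fun b hb => ?_) hsmall
  exact norm_ugaugeY_axialY_sub_one_le x hV c.1.1 c.1.2 ha hP (relY_add_unitVec_le_pairTop_of_readsY x c hb)

/-- `K_c(V)` is a unit under small curvature on the double block. [cite: Balaban1985BackgroundPropagators, (3.157) p.428, (3.35) p.397] -/
theorem isUnit_KY_of_plaqSmall {U : CfgY 𝔸 x.toKIdx} (hV : ∀ b, 𝔳 U b ∈ U1 𝔸)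
    (c : CBondY x) {a : ℝ} (ha : 0 ≤ a) (hP : B8Lemma1NonAbelian.PlaqSmall (VzY x (𝔳 U)) (labK x c.1.1) (labK x c.1.1 + pairTop (ℓ + 1) c.1.2) a)
    (hsmall : (((ℓ + 1 : ℕ) : ℝ)) ^ (d + 1) * (2 * ((((d * (2 * ℓ + 1) : ℕ) : ℝ)) * a) * (((ℓ + 1 : ℕ) + (d + 1) * ℓ : ℕ) : ℝ)) < 1) :
    IsUnit (KY x 𝔳 U c) :=
  (isUnit_KY_KTY_of_plaqSmall x 𝔳 hV c ha hP hsmall).1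

/-- `K_c(V)*` is a unit under small curvature on the double block. [cite: Balaban1985BackgroundPropagators, (3.157) p.428, (3.9) p.391, (3.35) p.397] -/
theorem isUnit_KTY_of_plaqSmall {U : CfgY 𝔸 x.toKIdx} (hV : ∀ b, 𝔳 U b ∈ U1 𝔸)
    (c : CBondY x) {a : ℝ} (ha : 0 ≤ a) (hP : B8Lemma1NonAbelian.PlaqSmall (VzY x (𝔳 U)) (labK x c.1.1) (labK x c.1.1 + pairTop (ℓ + 1) c.1.2) a)
    (hsmall : (((ℓ + 1 : ℕ) : ℝ)) ^ (d + 1) * (2 * ((((d * (2 * ℓ + 1) : ℕ) : ℝ)) * a) * (((ℓ + 1 : ℕ) + (d + 1) * ℓ : ℕ) : ℝ)) < 1) :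
    IsUnit (KTY x 𝔳 U c) :=
  (isUnit_KY_KTY_of_plaqSmall x 𝔳 hV c ha hP hsmall).2

end AxialUnit

/-! ## §5 At the record: `V = avYOfRecord x U`, `G ≤ U(N)` -/

section RecordAxial

open scoped Matrix.Norms.L2Operator
open B7Prop2Explicit (unitaryUnits)

variable (N : ℕ) (θ : Stage3Params) (Mstar : ℕ)

/-- ★★ **THE RECORD'S PIVOT COEFFICIENTS ARE UNITS UNDER (3.35) ON THE DOUBLE BLOCK**: for `G ≤ U(N)` (`N ≥ 1`), a `G`-valued background `U`, and the averaged
field of record `V = avYOfRecord x U` with plaquettes `a`-small on `[c₋, c₋ + pairTop L μ]` and `L^{d+1}·2(d(2ℓ+1)a)(L + (d+1)ℓ) < 1`, both `K_c(V)` and `K_c(V)*`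
are units (`U(N) ≤ U1` by the C⋆-norm; `G`-valuedness of `V` from `avYOfRecord_mem`). [cite: Balaban1985BackgroundPropagators, (3.157) p.428, (3.35) pp.396–397, (3.40) p.397;
Balaban1985Averaging, (55)–(58) p.27; Balaban1985RegularSpaces, Lemma 1 p.79] -/
theorem isUnit_KY_KTY_avYOfRecord_of_plaqSmall [NeZero N] (x : MemberY θ.d₆ θ.ℓ₆ θ.hd' θ.hL' θ.b₀ θ.b₁ Mstar)
    {G : Subgroup (Matrix (Fin N) (Fin N) ℂ)ˣ} (hG : G ≤ unitaryUnits (Matrix (Fin N) (Fin N) ℂ)) {U : CfgY (Matrix (Fin N) (Fin N) ℂ) x.toKIdx}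
    (hU : ∀ μ z, U μ z ∈ G) (c : CBondY x) {a : ℝ} (ha : 0 ≤ a)
    (hP : B8Lemma1NonAbelian.PlaqSmall (VzY x (avYOfRecord x U)) (labK x c.1.1) (labK x c.1.1 + pairTop (θ.ℓ₆ + 1) c.1.2) a)
    (hsmall : (((θ.ℓ₆ + 1 : ℕ) : ℝ)) ^ (θ.d₆ + 1) * (2 * ((((θ.d₆ * (2 * θ.ℓ₆ + 1) : ℕ) : ℝ)) * a) * (((θ.ℓ₆ + 1 : ℕ) + (θ.d₆ + 1) * θ.ℓ₆ : ℕ) : ℝ)) < 1) :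
    IsUnit (KY x (avYOfRecord x) U c) ∧ IsUnit (KTY x (avYOfRecord x) U c) :=
  have hG1 := norm_coe_le_one_of_le_unitaryUnits hG
  isUnit_KY_KTY_of_plaqSmall x (avYOfRecord x)
    (fun b => mem_U1.2 ⟨hG1 _ (avYOfRecord_mem x hU b), hG1 _ (G.inv_mem (avYOfRecord_mem x hU b))⟩) c ha hP hsmall

end RecordAxial

end Literature.MathematicalPhysics.QuantumFieldTheory.Balaban1983to89.Node00
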